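import Mathlib

/-!
# Concatenation powers of carry-robust chart codes (CKSU 2005, §6.3 — the amplifier)

Route `MatrixMultiplication/AutomaticSTPPDesigns`, crux `AutomaticPackingThesis`
(stmt-MatrixMultiplication-7356), line `Sketch`, stub `stub_chartPower` (support file).

A *chart* assigns digit sets `A(x), B(x), C(x) ⊆ Fin p` to every symbol `x ∈ Γ`; a code
`U ⊆ Γ^k` is *carry-robust* if every ordered triple `(u, v, w) ∈ U³`, not all equal, has a
witness coordinate `j` at which the six-term STPP digit combination
`(s' - s) + (t' - t) + (c' - c)` (`s ∈ A (w j)`, `s' ∈ A (u j)`, `t ∈ B (u j)`, `t' ∈ B (v j)`,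
`c ∈ C (v j)`, `c' ∈ C (w j)`) stays off `[-2, 2]` modulo `p`.

* `stub_chartPower` — the `m`-fold concatenation power `U^(m) ⊆ Γ^(m k)` (words all of whose `m`
  consecutive length-`k` blocks, block `t` sitting at the positions `finProdFinEquiv (t, j) = j + k t`,
  lie in `U`) is again carry-robust (a non-constant triple of `U^(m)` is non-constant in some block,
  and that block's witness coordinate is transported along `finProdFinEquiv`), and the packing
  functional `U ↦ Σ_{u ∈ U} (Π_j |A (u j)| |B (u j)| |C (u j)|)^τ` is multiplicative:
  its value on `U^(m)` is the `m`-th power of its value on `U` (split the product over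
  `Fin (m k) ≃ Fin m × Fin k`, distribute the real power over the nonnegative block masses, and
  re-index `U^(m) ≃ U^m = Fintype.piFinset (fun _ : Fin m ↦ U)`; `Finset.sum_pow'`).

## References

* H. Cohn, R. Kleinberg, B. Szegedy, C. Umans, *Group-theoretic algorithms for matrix
  multiplication*, FOCS 2005, arXiv:math/0511460, §6.3 (charts and their powers).
-/

-- single-conjunct summit: the mandated namespace repeats `MatrixMultiplication`.
set_option linter.dupNamespace false

namespace Summit.MatrixMultiplication.MatrixMultiplication.Theorems.AutomaticPackingThesis

open Finset

/-- A product over `Fin (m * k)` is the iterated product over the `m` blocks of length `k`,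
block `t` occupying the positions `finProdFinEquiv (t, j)`, `j < k`. [folklore] -/
theorem chartPower_prod_univ_fin_mul {M : Type*} [CommMonoid M] (m k : ℕ) (F : Fin (m * k) → M) :
    ∏ x, F x = ∏ t : Fin m, ∏ j : Fin k, F (finProdFinEquiv (t, j)) :=
  calc ∏ x, F x = ∏ q : Fin m × Fin k, F (finProdFinEquiv q) :=
        (Equiv.prod_comp finProdFinEquiv F).symm
    _ = ∏ t : Fin m, ∏ j : Fin k, F (finProdFinEquiv (t, j)) := Fintype.prod_prod_type _

/-- The real `τ`-th power of a natural-number product over `Fin (m * k)` is the product over the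
`m` blocks of the `τ`-th powers of the block products (the block products are nonnegative reals,
so `Real.rpow` distributes with no sign hypotheses on `τ`). [folklore] -/
theorem chartPower_cast_prod_rpow_blocks (m k : ℕ) (F : Fin (m * k) → ℕ) (τ : ℝ) :
    ((∏ x, F x : ℕ) : ℝ) ^ τ =
      ∏ t : Fin m, ((∏ j : Fin k, F (finProdFinEquiv (t, j)) : ℕ) : ℝ) ^ τ := by
  rw [chartPower_prod_univ_fin_mul m k F, Nat.cast_prod]
  exact (Real.finsetProd_rpow _ _ (fun _ _ => Nat.cast_nonneg _) τ).symm

/-- **Concatenation powers of a carry-robust chart code** (Cohn–Kleinberg–Szegedy–Umans 2005,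
§6.3, the amplifier behind Thm. 6.6 / Theorem 37 of the arXiv text). Let `A B C : Γ → Finset (Fin p)`
be digit sets and `U ⊆ Γ^k` a code in which every ordered triple `(u, v, w)`, not all equal, has a
coordinate `j` where `(s' - s) + (t' - t) + (c' - c) + e ≢ 0 (mod p)` for all digits
`s ∈ A (w j)`, `s' ∈ A (u j)`, `t ∈ B (u j)`, `t' ∈ B (v j)`, `c ∈ C (v j)`, `c' ∈ C (w j)` and all
carries `|e| ≤ 2`. Then the `m`-fold concatenation power `Um ⊆ Γ^(m k)` — the words whose `m`
blocks `j ↦ w (finProdFinEquiv (t, j))` all lie in `U` — has the same property (a non-constant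
triple is non-constant in some block `t`, whose witness coordinate `j` gives the witness
`finProdFinEquiv (t, j)`), and the packing functional is multiplicative:
`Σ_{w ∈ Um} (Π_{j < mk} |A (w j)| |B (w j)| |C (w j)|)^τ = (Σ_{u ∈ U} (Π_{j < k} |A (u j)| |B (u j)| |C (u j)|)^τ)^m`
for every real `τ`. [folklore] -/
theorem stub_chartPower (p k m : ℕ) (Γ : Type) [Fintype Γ] [DecidableEq Γ]
    (A B C : Γ → Finset (Fin p)) (U : Finset (Fin k → Γ))
    (hU : ∀ u ∈ U, ∀ v ∈ U, ∀ w ∈ U, ¬ (u = v ∧ v = w) → ∃ j : Fin k,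
      ∀ s ∈ A (w j), ∀ s' ∈ A (u j), ∀ t ∈ B (u j), ∀ t' ∈ B (v j), ∀ c ∈ C (v j),
        ∀ c' ∈ C (w j), ∀ e : ℤ, |e| ≤ 2 →
          (((((s' : ℕ) : ℤ) - (s : ℕ)) + (((t' : ℕ) : ℤ) - (t : ℕ)) + (((c' : ℕ) : ℤ) - (c : ℕ))
            + e : ℤ) : ZMod p) ≠ 0)
    (Um : Finset (Fin (m * k) → Γ))
    (hUm : ∀ w, w ∈ Um ↔ ∀ t : Fin m, (fun j : Fin k => w (finProdFinEquiv (t, j))) ∈ U)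
    (τ : ℝ) :
    (∀ u ∈ Um, ∀ v ∈ Um, ∀ w ∈ Um, ¬ (u = v ∧ v = w) → ∃ j : Fin (m * k),
      ∀ s ∈ A (w j), ∀ s' ∈ A (u j), ∀ t ∈ B (u j), ∀ t' ∈ B (v j), ∀ c ∈ C (v j),
        ∀ c' ∈ C (w j), ∀ e : ℤ, |e| ≤ 2 →
          (((((s' : ℕ) : ℤ) - (s : ℕ)) + (((t' : ℕ) : ℤ) - (t : ℕ)) + (((c' : ℕ) : ℤ) - (c : ℕ))
            + e : ℤ) : ZMod p) ≠ 0) ∧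
    ∑ w ∈ Um, ((∏ j, ((A (w j)).card * (B (w j)).card * (C (w j)).card) : ℕ) : ℝ) ^ τ =
      (∑ u ∈ U, ((∏ j, ((A (u j)).card * (B (u j)).card * (C (u j)).card) : ℕ) : ℝ) ^ τ) ^ m := by
  refine ⟨?_, ?_⟩
  · -- Part 1: `Um` is carry-robust.
    intro u hu v hv w hw hne
    have hu' := (hUm u).1 hu
    have hv' := (hUm v).1 hv
    have hw' := (hUm w).1 hw
    -- some block of the triple `(u, v, w)` is non-constant
    have hex : ∃ t : Fin m,
        ¬ ((fun j : Fin k => u (finProdFinEquiv (t, j))) = (fun j : Fin k => v (finProdFinEquiv (t, j))) ∧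
          (fun j : Fin k => v (finProdFinEquiv (t, j))) = (fun j : Fin k => w (finProdFinEquiv (t, j)))) := by
      by_contra h
      push Not at h
      apply hne
      constructor
      · funext x
        obtain ⟨⟨t, j⟩, rfl⟩ := finProdFinEquiv.surjective x
        exact congr_fun (h t).1 j
      · funext x
        obtain ⟨⟨t, j⟩, rfl⟩ := finProdFinEquiv.surjective x
        exact congr_fun (h t).2 j
    obtain ⟨t, ht⟩ := hex
    obtain ⟨j, hj⟩ := hU _ (hu' t) _ (hv' t) _ (hw' t) ht
    exact ⟨finProdFinEquiv (t, j), hj⟩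
  · -- Part 2: the packing functional is multiplicative.
    have hsplit : ∀ w : Fin (m * k) → Γ,
        ((∏ j, ((A (w j)).card * (B (w j)).card * (C (w j)).card) : ℕ) : ℝ) ^ τ =
          ∏ t : Fin m, ((∏ j : Fin k, ((A (w (finProdFinEquiv (t, j)))).card *
            (B (w (finProdFinEquiv (t, j)))).card * (C (w (finProdFinEquiv (t, j)))).card) : ℕ) :
              ℝ) ^ τ :=
      fun w => chartPower_cast_prod_rpow_blocks m k
        (fun x => (A (w x)).card * (B (w x)).card * (C (w x)).card) τ
    rw [Finset.sum_congr rfl (fun w (_ : w ∈ Um) => hsplit w), Finset.sum_pow']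
    refine Finset.sum_nbij' (fun w t j => w (finProdFinEquiv (t, j)))
      (fun f x => f (finProdFinEquiv.symm x).1 (finProdFinEquiv.symm x).2) ?_ ?_ ?_ ?_ ?_
    · -- blocks of a word of `Um` lie in `U`
      intro w hw
      exact Fintype.mem_piFinset.2 (fun t => (hUm w).1 hw t)
    · -- concatenations of words of `U` lie in `Um`
      intro f hf
      refine (hUm _).2 (fun t => ?_)
      have hft : f t ∈ U := Fintype.mem_piFinset.1 hf t
      convert hft using 1
      funext j
      simp only [Equiv.symm_apply_apply]
    · intro w _
      funext x
      simp only [Prod.mk.eta, Equiv.apply_symm_apply]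
    · intro f _
      funext t j
      simp only [Equiv.symm_apply_apply]
    · intro w _
      rfl

end Summit.MatrixMultiplication.MatrixMultiplication.Theorems.AutomaticPackingThesis
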